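import Summits.ResolutionOfSingularities.ResolutionOfSingularities.Theorems.FrobeniusLadderFRationalResolutionSegreSummand
import Summits.ResolutionOfSingularities.ResolutionOfSingularities.Theorems.FrobeniusLadderFRationalResolutionSegreMemIff
import Summits.ResolutionOfSingularities.ResolutionOfSingularities.Theorems.FrobeniusLadderFRationalResolutionSegreBipartiteSplit
import Summits.ResolutionOfSingularities.ResolutionOfSingularities.Theorems.FrobeniusLadderFRationalResolutionClauseOfRetractRegular
import Mathlib.RingTheory.RegularLocalRing.Polynomial
import HarnessLib

/-!
# Cone programme: the Segre cones `Spec k[xᵢyⱼ]` lie in the residual class (domains with every ideal tightly closed)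

Support file for crux stmt-ResolutionOfSingularities-15317 (`FrobeniusLadder.FRationalResolution`), line `redirect`,
CONE PROGRAMME. For every prime `p`, every field `k` of characteristic `p` and all `a, b`, the Segre ring
`SR[a,b] = k[xᵢyⱼ] ⊆ k[x₁,…,x_a,y₁,…,y_b]` is a domain in which EVERY ideal is tightly closed in the inline sense of route
`FrobeniusLadder` (`c ≠ 0 ∧ (∀ e, c·y^(p^e) ∈ span {z^(p^e) | z ∈ I}) ⇒ y ∈ I`) — a fortiori every parameter ideal of
every local ring of the Segre cone is tightly closed (the hypothesis class of the crux, rung 4′): `SR[a,b]` is a direct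
summand of the regular domain `k[x,y]` (`stub_segre_retract`, with the membership criterion `stub_segre_mem_iff` and the
bipartite splitting `stub_finsupp_bipartite_split`), and direct summands of regular domains have every ideal tightly
closed (`stub_clause_of_retract_regular`, Hochster–Huneke 1990 Prop. 4.12). Together with `hasResolution_segreCone`
(`…SegreConeResolution.lean`) this makes the Segre cones — dimension `a + b − 1`, not ℚ-Gorenstein for `a ≠ b` — members
of the residual class of the crux with a resolution in Lean, in every dimension and every characteristic.
[folklore; BrunsHerzog1998 §6.1; HochsterHuneke1990 Prop. 4.12] -/

-- single-problem summit: the doubled namespace component is forced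
set_option linter.dupNamespace false

noncomputable section

namespace Summit.ResolutionOfSingularities.ResolutionOfSingularities.Theorems.FRationalResolution

open MvPolynomial
open Literature.AlgebraicGeometry.Resolution

section Cones

variable (k : Type) [Field k]

/-- The polynomial ring in two blocks of `a` and `b` variables `xᵢ = X (inl i)`, `yⱼ = X (inr j)`. -/
local notation3 "SP[" a ", " b "]" => MvPolynomial (Fin a ⊕ Fin b) k

/-- The Segre ring `k[xᵢyⱼ] ⊆ k[x, y]`: coordinate ring of the affine cone over the Segre embedding of
`ℙᵃ⁻¹ × ℙᵇ⁻¹`. -/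
local notation3 "SR[" a ", " b "]" =>
  Algebra.adjoin k (Set.range (fun ij : Fin a × Fin b =>
    (MvPolynomial.X (Sum.inl ij.1) * MvPolynomial.X (Sum.inr ij.2) : MvPolynomial (Fin a ⊕ Fin b) k)))

/-- **The Segre cones lie in the residual class (all primes `p`, all fields `k` of characteristic `p`, all `a, b`).**
`SR[a,b] = k[xᵢyⱼ]` is a domain and every ideal `I` of it is tightly closed in the inline sense of route
`FrobeniusLadder`: direct summand of the regular domain `k[x,y]` (`stub_segre_retract` over `stub_segre_mem_iff` and
`stub_finsupp_bipartite_split`), and Hochster–Huneke 1990 Prop. 4.12 in ring-map form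
(`stub_clause_of_retract_regular`). [folklore; HochsterHuneke1990 Prop. 4.12] -/
theorem segreCone_residualClass (p : ℕ) [Fact p.Prime] [CharP k p] (a b : ℕ) :
    IsDomain ↥SR[a, b] ∧ ∀ I : Ideal ↥SR[a, b], ∀ y c : ↥SR[a, b], c ≠ 0 →
      (∀ e : ℕ, c * y ^ p ^ e ∈ Ideal.span ((fun z : ↥SR[a, b] => z ^ p ^ e) '' (I : Set ↥SR[a, b]))) → y ∈ I := by
  obtain ⟨ρ, h1, h2⟩ := stub_segre_retract k a b
    (stub_segre_mem_iff k a b (fun s d h₁ h₂ => stub_finsupp_bipartite_split s d h₁ h₂))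
  haveI : CharP SP[a, b] p := inferInstance
  exact stub_clause_of_retract_regular p (SR[a, b]).val.toRingHom ρ Subtype.val_injective h1 h2

end Cones

end Summit.ResolutionOfSingularities.ResolutionOfSingularities.Theorems.FRationalResolution

end
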